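import Literature.AlgebraicGeometry.FormalGeometry.WittGEUnitBoundCompletion
import Literature.AlgebraicGeometry.FormalGeometry.WittGEUnitBoundSubscheme
import HarnessLib

/-!
# GW II Lemma 24.105 step (II); Grothendieck's existence theorem for proper schemes

Row b03 / crux `AnchorTransport.VariationalHodge` (stmt-HodgeConjecture-1076), line padic-disc-transport,
STUB P (`…_of_grothendieckExistence` rungs). This file closes the programme of
`…GrothendieckExistenceProper` / `…UnitBoundAlgebraic` / `…UnitBoundSubscheme`: there Grothendieck's
existence theorem for a PROPER scheme over a complete noetherian ring (Görtz–Wedhorn II Thm. 24.94,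
EGA III₁ 5.1.4, Stacks 088C; towers along one global function) was reduced to step (II) of GW II
Lemma 24.105 — the uniform bound on the kernels and cokernels of the units `𝓖_n → π_*π^*𝓖_n` of a
proper `π : Z' → Z` which is an isomorphism over an open `U`, for an ARBITRARY coherent formal tower
`𝓖` on `Z`. Here that step is proved, as printed ("we may work locally on `X` and hence assume that
`X = Spec B` is affine … (II) we can replace `B` by `B̂`", p. 574):

* `bound_restrict_of_eq_top`, `ΓSpecIso_inv_mem_pow_mul_pow` — bookkeeping on an affine open `V`
  (restriction to `ι⁻¹V = ⊤` of `Spec Γ(V) → Z`; the ideal `(b)ᶜ·𝒥_Uᵈ` read on `Spec Γ(V)`);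
* `exists_sectionsBound_affineOpen` — the bound on SECTIONS over an affine open `V ⊆ Z`: base change
  to the chart `Spec Γ(Z, V) → Z` (`…UnitSections.unit_app_baseChange`, units of open immersions
  are bijective over their image) and `…UnitBoundCompletion.exists_sectionsBound_affine`;
* **`unitBound`** — the sheaf statement on `Z` (noetherian): `∃ c d, ∀ n`, kernel and cokernel of
  `𝓖_n → π_*π^*𝓖_n` are killed by `(b)ᶜ·𝒥_Uᵈ` (a finite affine cover, `IsKilledBy.of_iSup_eq_top`);
* **`exists_coh_iso_cmplTower_of_isProper`** — GROTHENDIECK'S EXISTENCE THEOREM: every coherent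
  formal tower along `a` on `X` proper over `Spec A`, `A` noetherian and `a`-adically complete, is
  the completion tower `(F/aⁿ⁺¹F)_n` of a coherent `𝒪_X`-module `F`;
* the consequences for vector bundles on proper `W(k)`-schemes (the Literature named facts
  `GrothendieckExistence_vectorBundle_witt`, `GortzWedhorn2023_prop2495_wittVector`) are drawn in
  `…GrothendieckExistenceVectorBundlesWitt`.

HONEST FRAMING: research route conditional on HC_CM; not a corollary; Q11.4-sentence-2 already
refuted in dim ≥ 3. Nothing here bears on `HC_CM`; no case of the Hodge conjecture is proved.

References: GortzWedhorn2023 (II: Thm. 24.94, Prop. 24.95, Lemma 24.103–24.105, pp. 566–575);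
EGAIII1 (Thm. 5.1.4); StacksProject (Tags 087X, 088B, 088C).

Provenance: Literature home (family `hodge`, layer `Literature/AlgebraicGeometry/FormalGeometry`, namespace
`Literature.AlgebraicGeometry.FormalGeometry.WittGrothendieckExistence…`) of the Summits-side
`Theorems/AnchorTransportVariationalHodgePadicGrothendieckExistenceUnitBoundStepII` (route `PadicSemiregularLift` / `AnchorTransport`,
Grothendieck existence for vector bundles over `W(k)`), which `Literature/` may not import; theorems only, no
named fact, no definition. Lane `lit-hodgefound`, seat p20.
-/

noncomputable section

-- `TopCat.Presheaf`/`Scheme.Modules` are not reducible (as in Mathlib's `AlgebraicGeometry/Modules`).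
set_option backward.isDefEq.respectTransparency false

open CategoryTheory CategoryTheory.Limits _root_.AlgebraicGeometry TopologicalSpace Opposite
open Literature.AlgebraicGeometry.Modules Literature.AlgebraicGeometry.Morphisms
open Literature.AlgebraicGeometry.Motives

universe u

namespace Literature.AlgebraicGeometry.FormalGeometry.WittGrothendieckExistence

namespace GrothendieckExistenceProper

open FormalVectorBundlesAlgebraize

/-! ### Bookkeeping on an affine open -/

section Bookkeeping

variable {S P : Scheme.{u}} (q : P ⟶ S) (N : S.Modules)

/-- **Bounds restrict from `⊤` to an open `W = ⊤`** (restriction between equal opens is bijective and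
semilinear; the unit commutes with restriction). [cite: GortzWedhorn2023, proof of Thm. 24.94 and Prop. 24.95 (pp. 566–567), auxiliary step] -/
theorem bound_restrict_of_eq_top {W : S.Opens} (hW : W = ⊤) {r₀ : Γ(S, ⊤)}
    (hk : ∀ m : Γ(N, ⊤), ((Scheme.Modules.pullbackPushforwardAdjunction q).unit.app N).app ⊤ m = 0 →
      r₀ • m = 0)
    (hi : ∀ t : Γ((Scheme.Modules.pushforward q).obj ((Scheme.Modules.pullback q).obj N), ⊤),
      ∃ m : Γ(N, ⊤), ((Scheme.Modules.pullbackPushforwardAdjunction q).unit.app N).app ⊤ m = r₀ • t) :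
    (∀ m : Γ(N, W), ((Scheme.Modules.pullbackPushforwardAdjunction q).unit.app N).app W m = 0 →
      S.presheaf.map (homOfLE (le_top : W ≤ ⊤)).op r₀ • m = 0) ∧
    (∀ t : Γ((Scheme.Modules.pushforward q).obj ((Scheme.Modules.pullback q).obj N), W),
      ∃ m : Γ(N, W), ((Scheme.Modules.pullbackPushforwardAdjunction q).unit.app N).app W m =
        S.presheaf.map (homOfLE (le_top : W ≤ ⊤)).op r₀ • t) :=
  bound_of_square_up (S.presheaf.map (homOfLE (le_top : W ≤ ⊤)).op).hom
    (fun m => ((Scheme.Modules.pullbackPushforwardAdjunction q).unit.app N).app ⊤ m)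
    (fun m => ((Scheme.Modules.pullbackPushforwardAdjunction q).unit.app N).app W m)
    (fun m => N.presheaf.map (homOfLE (le_top : W ≤ ⊤)).op m)
    (fun t => ((Scheme.Modules.pushforward q).obj ((Scheme.Modules.pullback q).obj N)).presheaf.map
      (homOfLE (le_top : W ≤ ⊤)).op t)
    (fun r m => Scheme.Modules.map_smul N _ r m)
    (fun r t => Scheme.Modules.map_smul _ _ r t)
    (fun m => (Scheme.Modules.Hom.app_map_apply _ (homOfLE (le_top : W ≤ ⊤)) m).symm)
    (presheaf_map_bijective_of_eq' N hW.symm _).2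
    (presheaf_map_bijective_of_eq' _ hW.symm _) hk hi

variable {Z : Scheme.{u}} (V : Z.affineOpens)

/-- Restriction of the structure sheaf of `Spec B` along `⊤ ≤ ⊤` is the identity. [cite: GortzWedhorn2023, proof of Thm. 24.94 and Prop. 24.95 (pp. 566–567), auxiliary step] -/
theorem presheaf_map_top_top {X : Scheme.{u}} (x : Γ(X, ⊤)) :
    X.presheaf.map (homOfLE (le_top : (⊤ : X.Opens) ≤ ⊤)).op x = x := by
  rw [Subsingleton.elim (homOfLE (le_top : (⊤ : X.Opens) ≤ ⊤)) (𝟙 _), op_id, X.presheaf.map_id]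
  rfl

/-- The chart `Spec Γ(Z, V) → Z` on global sections: `ι♯(s) = (Γ(Spec Γ(V)) ≅ Γ(V))⁻¹ (s|_V)`. [cite: GortzWedhorn2023, proof of Thm. 24.94 and Prop. 24.95 (pp. 566–567), auxiliary step] -/
theorem fromSpec_appTop (s : Γ(Z, ⊤)) :
    V.2.fromSpec.appTop s = (Scheme.ΓSpecIso Γ(Z, V)).inv
      (Z.presheaf.map (homOfLE (le_top : (V : Z.Opens) ≤ ⊤)).op s) := by
  change V.2.fromSpec.app ⊤ s = _
  rw [IsAffineOpen.fromSpec_app_of_le V.2 ⊤ le_top]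
  change (Spec Γ(Z, V)).presheaf.map (homOfLE le_top).op
    ((Scheme.ΓSpecIso Γ(Z, V)).inv (Z.presheaf.map (homOfLE le_top).op s)) = _
  exact presheaf_map_top_top _

/-- The chart on sections over `V`: `ι♯_V(r) = ((Γ(Spec Γ(V)) ≅ Γ(V))⁻¹ r)|_{ι⁻¹V}`. [cite: GortzWedhorn2023, proof of Thm. 24.94 and Prop. 24.95 (pp. 566–567), auxiliary step] -/
theorem fromSpec_app_self_apply (r : Γ(Z, V)) :
    V.2.fromSpec.app V r = (Spec Γ(Z, V)).presheaf.map
      (homOfLE (le_top : V.2.fromSpec ⁻¹ᵁ (V : Z.Opens) ≤ ⊤)).op ((Scheme.ΓSpecIso Γ(Z, V)).inv r) := by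
  have h := congrArg (fun φ => φ.hom ((Scheme.ΓSpecIso Γ(Z, V)).inv r))
    (IsAffineOpen.ΓSpecIso_hom_fromSpec_app V.2)
  simp only [CommRingCat.hom_comp, RingHom.coe_comp, Function.comp_apply] at h
  change V.2.fromSpec.app V (((Scheme.ΓSpecIso Γ(Z, V)).inv ≫ (Scheme.ΓSpecIso Γ(Z, V)).hom) r) = _
    at h
  rw [Iso.inv_hom_id] at h
  refine h.trans ?_
  exact congrArg (fun k : V.2.fromSpec ⁻¹ᵁ (V : Z.Opens) ⟶ ⊤ =>
    (Spec Γ(Z, V)).presheaf.map k.op ((Scheme.ΓSpecIso Γ(Z, V)).inv r)) (Subsingleton.elim _ _)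

/-- **The vanishing ideal of `Z ∖ U` on `V`, read on `Spec Γ(Z, V)`**: for `s ∈ 𝒥_U(V)`,
`(Γ(Spec Γ(V)) ≅ Γ(V))⁻¹ s` lies in the vanishing ideal of `Spec Γ(V) ∖ ι⁻¹U` (global sections). [cite: GortzWedhorn2023, proof of Thm. 24.94 and Prop. 24.95 (pp. 566–567), auxiliary step] -/
theorem ΓSpecIso_inv_mem_vanishingIdeal (U : Z.Opens) {s : Γ(Z, V)}
    (hs : s ∈ (Scheme.IdealSheafData.vanishingIdeal U.compl).ideal V) :
    (Scheme.ΓSpecIso Γ(Z, V)).inv s ∈ (Scheme.IdealSheafData.vanishingIdeal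
      (V.2.fromSpec ⁻¹ᵁ U).compl).ideal ⟨⊤, isAffineOpen_top _⟩ := by
  rw [Scheme.IdealSheafData.vanishingIdeal_ideal, PrimeSpectrum.mem_vanishingIdeal] at hs ⊢
  intro q hq
  have hq' : (Spec.map (Scheme.ΓSpecIso Γ(Z, V)).inv) q ∈
      V.2.fromSpec ⁻¹' ((U.compl : Closeds Z) : Set Z) := by
    have e : (⟨⊤, isAffineOpen_top (Spec Γ(Z, V))⟩ : (Spec Γ(Z, V)).affineOpens).2.fromSpec =
        Spec.map (Scheme.ΓSpecIso Γ(Z, V)).inv := by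
      rw [← Scheme.isoSpec_Spec_inv]
      exact IsAffineOpen.fromSpec_top
    rw [e] at hq
    exact hq
  have h := hs _ hq'
  rw [Spec.map_apply, PrimeSpectrum.comap_asIdeal, Ideal.mem_comap] at h
  exact h

/-- **The ideal `(b)ᶜ·𝒥_Uᵈ` on `V`, read on `Spec Γ(Z, V)`**: for `r ∈ ((b)ᶜ·𝒥_Uᵈ)(V)`,
`(Γ(Spec Γ(V)) ≅ Γ(V))⁻¹ r ∈ (b|_V)ᶜ·𝒥_{ι⁻¹U}ᵈ` (global sections of `Spec Γ(Z, V)`). [cite: GortzWedhorn2023, proof of Thm. 24.94 and Prop. 24.95 (pp. 566–567), auxiliary step] -/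
theorem ΓSpecIso_inv_mem_pow_mul_pow (bZ : Γ(Z, ⊤)) (U : Z.Opens) (c d : ℕ) {r : Γ(Z, V)}
    (hr : r ∈ (Scheme.IdealSheafData.ofIdealTop (Ideal.span {bZ}) ^ c *
      Scheme.IdealSheafData.vanishingIdeal U.compl ^ d).ideal V) :
    (Scheme.ΓSpecIso Γ(Z, V)).inv r ∈
      (Scheme.IdealSheafData.ofIdealTop (Ideal.span {(Scheme.ΓSpecIso Γ(Z, V)).inv
          (Z.presheaf.map (homOfLE (le_top : (V : Z.Opens) ≤ ⊤)).op bZ)}) ^ c *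
        Scheme.IdealSheafData.vanishingIdeal (V.2.fromSpec ⁻¹ᵁ U).compl ^ d).ideal
        ⟨⊤, isAffineOpen_top _⟩ := by
  simp only [Scheme.IdealSheafData.ideal_mul, Scheme.IdealSheafData.ideal_pow, Pi.mul_apply,
    Pi.pow_apply] at hr ⊢
  have h := Ideal.mem_map_of_mem (Scheme.ΓSpecIso Γ(Z, V)).inv.hom hr
  rw [Ideal.map_mul, Ideal.map_pow, Ideal.map_pow] at h
  refine Ideal.mul_mono (Ideal.pow_right_mono ?_ c) (Ideal.pow_right_mono ?_ d) h
  · rw [Scheme.IdealSheafData.ofIdealTop_ideal, Scheme.IdealSheafData.ofIdealTop_ideal,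
      Ideal.map_map, Ideal.map_span, Ideal.map_span, Set.image_singleton, Set.image_singleton]
    apply Ideal.span_mono
    rw [Set.singleton_subset_iff, Set.mem_singleton_iff]
    exact (presheaf_map_top_top _).symm
  · exact Ideal.map_le_iff_le_comap.mpr fun s hs => ΓSpecIso_inv_mem_vanishingIdeal V U hs

/-- Larger exponents give smaller ideals: `(b)^C·𝒥^D ≤ (b)ᶜ·𝒥ᵈ` for `c ≤ C`, `d ≤ D`. [cite: GortzWedhorn2023, proof of Thm. 24.94 and Prop. 24.95 (pp. 566–567), auxiliary step] -/
theorem pow_mul_pow_le_of_le (I J : Z.IdealSheafData) {c C d D : ℕ} (hc : c ≤ C) (hd : d ≤ D) :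
    I ^ C * J ^ D ≤ I ^ c * J ^ d := by
  refine Scheme.IdealSheafData.le_def.mpr fun W => ?_
  simp only [Scheme.IdealSheafData.ideal_mul, Scheme.IdealSheafData.ideal_pow, Pi.mul_apply,
    Pi.pow_apply]
  exact Ideal.mul_mono (Ideal.pow_le_pow_right hc) (Ideal.pow_le_pow_right hd)

end Bookkeeping

/-! ### Step (II) on an affine open -/

section AffineOpen

variable {Z' Z : Scheme.{u}} (π : Z' ⟶ Z) [IsProper π] [IsLocallyNoetherian Z]
  (bZ : Γ(Z, ⊤)) (U : Z.Opens) [IsIso (π ∣_ U)] {𝓖 : ℕᵒᵖ ⥤ Z.Modules} (h𝓖 : IsFormalTower bZ 𝓖)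
  (h𝓖c : ∀ n, Coh (𝓖.obj ⟨n⟩))

include h𝓖 h𝓖c in
/-- **Step (II) of GW II Lemma 24.105 on SECTIONS over an affine open `V ⊆ Z`**: there are `c, d`
such that for every `n` and every `r ∈ ((b)ᶜ·𝒥_Uᵈ)(V)`: `r` kills the kernel of
`Γ(V, 𝓖_n) → Γ(π⁻¹V, π^*𝓖_n)` and `r · Γ(π⁻¹V, π^*𝓖_n)` lies in its image (base change to the
chart `Spec Γ(Z, V) → Z` and `exists_sectionsBound_affine`). [cite: GortzWedhorn2023, proof of Thm. 24.94 and Prop. 24.95 (pp. 566–567), auxiliary step] -/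
theorem exists_sectionsBound_affineOpen (V : Z.affineOpens) :
    ∃ c d : ℕ, ∀ (n : ℕ) (r : Γ(Z, V)),
      r ∈ (Scheme.IdealSheafData.ofIdealTop (Ideal.span {bZ}) ^ c *
        Scheme.IdealSheafData.vanishingIdeal U.compl ^ d).ideal V →
      (∀ m : Γ(𝓖.obj ⟨n⟩, V),
        ((Scheme.Modules.pullbackPushforwardAdjunction π).unit.app (𝓖.obj ⟨n⟩)).app V m = 0 →
          r • m = 0) ∧
      (∀ t : Γ((Scheme.Modules.pushforward π).obj ((Scheme.Modules.pullback π).obj (𝓖.obj ⟨n⟩)), V),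
        ∃ m : Γ(𝓖.obj ⟨n⟩, V),
          ((Scheme.Modules.pullbackPushforwardAdjunction π).unit.app (𝓖.obj ⟨n⟩)).app V m = r • t) := by
  haveI : IsNoetherianRing Γ(Z, V) := IsLocallyNoetherian.component_noetherian V
  -- the chart `ι : Spec B → Z`, `B = Γ(Z, V)`, and the base change `p : Z' ×_Z Spec B → Spec B`
  haveI : IsIso ((pullback.snd π V.2.fromSpec) ∣_ (V.2.fromSpec ⁻¹ᵁ U)) :=
    isIso_morphismRestrict_pullback_snd π V.2.fromSpec U
  have hιV : V.2.fromSpec ⁻¹ᵁ (V : Z.Opens) = ⊤ := V.2.fromSpec_preimage_self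
  have hιr : (V : Z.Opens) ≤ V.2.fromSpec.opensRange := by rw [IsAffineOpen.opensRange_fromSpec]
  have hι'r : π ⁻¹ᵁ (V : Z.Opens) ≤ (pullback.fst π V.2.fromSpec).opensRange := by
    intro x hx
    change x ∈ Set.range (pullback.fst π V.2.fromSpec)
    rw [Scheme.Pullback.range_fst, IsAffineOpen.range_fromSpec]
    exact hx
  -- the tower `ι^*𝓖` on `Spec B` along `b = bZ|_V`
  obtain ⟨b, hb⟩ : ∃ b : Γ(Z, V), b = Z.presheaf.map (homOfLE (le_top : (V : Z.Opens) ≤ ⊤)).op bZ :=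
    ⟨_, rfl⟩
  have hbι : V.2.fromSpec.appTop bZ = algebraMapΓ (𝟙 (Spec (.of Γ(Z, V)))) b := by
    rw [fromSpec_appTop, ← hb, algebraMapΓ, Scheme.Hom.id_appTop]
    rfl
  have hT : IsFormalTower (algebraMapΓ (𝟙 (Spec (.of Γ(Z, V)))) b)
      (𝓖 ⋙ Scheme.Modules.pullback V.2.fromSpec) := by
    rw [← hbι]; exact h𝓖.comp_pullback V.2.fromSpec
  have hTc : ∀ n, Coh ((𝓖 ⋙ Scheme.Modules.pullback V.2.fromSpec).obj ⟨n⟩) :=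
    coh_comp_pullback V.2.fromSpec h𝓖c
  obtain ⟨c, d, hcd⟩ := exists_sectionsBound_affine b (pullback.snd π V.2.fromSpec)
    (V.2.fromSpec ⁻¹ᵁ U) hT hTc
  refine ⟨c, d, fun n r hr => ?_⟩
  -- the element `r₀ = (ΓSpecIso B)⁻¹ r` of `Γ(Spec B, ⊤)` and its ideal membership
  have hr₀ : (Scheme.ΓSpecIso Γ(Z, V)).inv r ∈
      (Scheme.IdealSheafData.ofIdealTop (Ideal.span {algebraMapΓ (𝟙 (Spec (.of Γ(Z, V)))) b}) ^ c *
        Scheme.IdealSheafData.vanishingIdeal (V.2.fromSpec ⁻¹ᵁ U).compl ^ d).ideal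
        ⟨⊤, isAffineOpen_top _⟩ := by
    rw [← hbι, fromSpec_appTop]
    exact ΓSpecIso_inv_mem_pow_mul_pow V bZ U c d hr
  -- bounds on `Spec B`: over `⊤`, then over `ι⁻¹V = ⊤`
  have bd1 := hcd n _ hr₀
  have bd2 := bound_restrict_of_eq_top (pullback.snd π V.2.fromSpec)
    ((Scheme.Modules.pullback V.2.fromSpec).obj (𝓖.obj ⟨n⟩)) hιV bd1.1 bd1.2
  rw [← fromSpec_app_self_apply V r] at bd2
  -- down along the base-change square of the open immersion `ι`
  exact bound_of_square_down (V.2.fromSpec.app V).hom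
    (fun m => ((Scheme.Modules.pullbackPushforwardAdjunction π).unit.app (𝓖.obj ⟨n⟩)).app V m)
    (fun m' => ((Scheme.Modules.pullbackPushforwardAdjunction (pullback.snd π V.2.fromSpec)).unit.app
      ((Scheme.Modules.pullback V.2.fromSpec).obj (𝓖.obj ⟨n⟩))).app (V.2.fromSpec ⁻¹ᵁ V) m')
    (fun m => ((Scheme.Modules.pullbackPushforwardAdjunction V.2.fromSpec).unit.app (𝓖.obj ⟨n⟩)).app V m)
    (fun t => ((Scheme.Modules.pullback (pullback.snd π V.2.fromSpec)).obj
        ((Scheme.Modules.pullback V.2.fromSpec).obj (𝓖.obj ⟨n⟩))).presheaf.map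
        (homOfLE (preimage_preimage_eq_of_comp_eq π V.2.fromSpec (pullback.fst π V.2.fromSpec)
          (pullback.snd π V.2.fromSpec) pullback.condition V).ge).op
      ((((Scheme.Modules.pullbackPushforwardAdjunction (pullback.fst π V.2.fromSpec)).unit.app
          ((Scheme.Modules.pullback π).obj (𝓖.obj ⟨n⟩))) ≫
        (Scheme.Modules.pushforward (pullback.fst π V.2.fromSpec)).map
          ((Scheme.Modules.pullbackComp (pullback.fst π V.2.fromSpec) π).hom.app (𝓖.obj ⟨n⟩) ≫
            (Scheme.Modules.pullbackCongr pullback.condition).hom.app (𝓖.obj ⟨n⟩) ≫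
            (Scheme.Modules.pullbackComp (pullback.snd π V.2.fromSpec) V.2.fromSpec).inv.app
              (𝓖.obj ⟨n⟩))).app (π ⁻¹ᵁ V) t))
    (fun r m => Scheme.Modules.Hom.app_smul _ r m)
    (fun r t => baseChange_app_smul π V.2.fromSpec (pullback.fst π V.2.fromSpec)
      (pullback.snd π V.2.fromSpec) pullback.condition (𝓖.obj ⟨n⟩) V r t)
    (fun m => unit_app_baseChange π V.2.fromSpec (pullback.fst π V.2.fromSpec)
      (pullback.snd π V.2.fromSpec) pullback.condition (𝓖.obj ⟨n⟩) V m)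
    (unit_app_bijective_of_le_opensRange V.2.fromSpec (𝓖.obj ⟨n⟩) hιr)
    (baseChange_app_bijective π V.2.fromSpec (pullback.fst π V.2.fromSpec)
      (pullback.snd π V.2.fromSpec) pullback.condition (𝓖.obj ⟨n⟩) V
      (unit_app_bijective_of_le_opensRange (pullback.fst π V.2.fromSpec)
        ((Scheme.Modules.pullback π).obj (𝓖.obj ⟨n⟩)) hι'r)).1
    bd2.1 bd2.2

end AffineOpen

/-! ### Step (II): the sheaf statement -/

section StepII

variable {Z' Z : Scheme.{u}} (π : Z' ⟶ Z) [IsProper π] [IsLocallyNoetherian Z] [CompactSpace Z]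
  (bZ : Γ(Z, ⊤)) (U : Z.Opens) [IsIso (π ∣_ U)] {𝓖 : ℕᵒᵖ ⥤ Z.Modules} (h𝓖 : IsFormalTower bZ 𝓖)
  (h𝓖c : ∀ n, Coh (𝓖.obj ⟨n⟩))

include h𝓖 h𝓖c in
/-- **GW II Lemma 24.105, step (II)** (on the tree's carriers; Görtz–Wedhorn II, proof of Lemma 24.105,
p. 574–575; Stacks 088C). Let `π : Z' → Z` be proper, `Z` noetherian, `π` an isomorphism over the
open `U ⊆ Z`, `b ∈ Γ(Z, 𝒪_Z)` and `𝓖` a coherent formal tower on `Z` along `b`. Then there are `c, d`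
such that for EVERY `n` the unit `𝓖_n → π_*π^*𝓖_n` has kernel and cokernel killed by `(b)ᶜ·𝒥_Uᵈ`,
`𝒥_U` the vanishing ideal sheaf of `Z ∖ U`. [cite: GortzWedhorn2023, proof of Thm. 24.94 and Prop. 24.95 (pp. 566–567), auxiliary step] -/
theorem unitBound :
    ∃ c d : ℕ, ∀ n : ℕ,
      IsKilledBy (Scheme.IdealSheafData.ofIdealTop (Ideal.span {bZ}) ^ c *
          Scheme.IdealSheafData.vanishingIdeal U.compl ^ d)
        (kernel ((Scheme.Modules.pullbackPushforwardAdjunction π).unit.app (𝓖.obj ⟨n⟩))) ∧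
      IsKilledBy (Scheme.IdealSheafData.ofIdealTop (Ideal.span {bZ}) ^ c *
          Scheme.IdealSheafData.vanishingIdeal U.compl ^ d)
        (cokernel ((Scheme.Modules.pullbackPushforwardAdjunction π).unit.app (𝓖.obj ⟨n⟩))) := by
  classical
  haveI : IsLocallyNoetherian Z' := LocallyOfFiniteType.isLocallyNoetherian π
  haveI : CompactSpace Z' := QuasiCompact.compactSpace_of_compactSpace π
  obtain ⟨t, ht⟩ := exists_finite_affineOpens_iSup_eq_top (X := Z)
  choose c d hcd using fun V : t => exists_sectionsBound_affineOpen π bZ U h𝓖 h𝓖c (V : Z.affineOpens)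
  refine ⟨Finset.univ.sup c, Finset.univ.sup d, fun n => ?_⟩
  refine isKilledBy_kernel_cokernel_of_sections_bound _ (h𝓖c n)
    (coh_pushforward_of_isProper π (coh_pullback π _ (h𝓖c n))) _ (fun V : t => (V : Z.affineOpens)) ht
    fun V r hr => hcd V n r ?_
  exact Scheme.IdealSheafData.le_def.mp (pow_mul_pow_le_of_le _ _
    (Finset.le_sup (Finset.mem_univ V)) (Finset.le_sup (Finset.mem_univ V))) _ hr

end StepII

/-! ### Grothendieck's existence theorem for proper schemes -/

section Proper

variable {A : Type u} [CommRing A] [IsNoetherianRing A] {X : Scheme.{u}} (f : X ⟶ Spec (.of A))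
  [IsProper f] (a₀ : A) [IsAdicComplete (Ideal.span {a₀}) A]

/-- **Grothendieck's existence theorem for a proper scheme** (Görtz–Wedhorn II Thm. 24.94 /
Lemma 24.103; EGA III₁ Thm. 5.1.4; Stacks Tag 088C — for towers along one global function): for `A`
noetherian and `a`-adically complete and `X → Spec A` PROPER, every formal tower of coherent
`𝒪_X`-modules along `a` (`aⁿ⁺¹𝓕_n = 0`, `𝓕_n = 𝓕_{n+1}/aⁿ⁺¹𝓕_{n+1}`) is algebraizable: the
completion tower `(F/aⁿ⁺¹F)_n` of a coherent `𝒪_X`-module `F` is isomorphic, as a tower, to `𝓕`.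
Unconditional: the unit bound of GW II Lemma 24.105 required by
`exists_coh_iso_cmplTower_of_subschemeUnitBound` is `unitBound`. [cite: GortzWedhorn2023, proof of Thm. 24.94 and Prop. 24.95 (pp. 566–567), auxiliary step] -/
theorem exists_coh_iso_cmplTower_of_isProper {𝓕 : ℕᵒᵖ ⥤ X.Modules}
    (hT : IsFormalTower (algebraMapΓ f a₀) 𝓕) (hTc : ∀ n, Coh (𝓕.obj ⟨n⟩)) :
    ∃ F : X.Modules, Coh F ∧ Nonempty (cmplTower (algebraMapΓ f a₀) F ≅ 𝓕) := by
  haveI : IsLocallyNoetherian X := LocallyOfFiniteType.isLocallyNoetherian f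
  haveI : CompactSpace X := QuasiCompact.compactSpace_of_compactSpace f
  obtain ⟨F, hF, ⟨e⟩⟩ := exists_coh_iso_cmplTower_of_subschemeUnitBound f a₀
    (fun K _ Z' π _ U' _ hU' 𝓖 hG hGc => by
      haveI : IsLocallyNoetherian K.subscheme :=
        LocallyOfFiniteType.isLocallyNoetherian K.subschemeι
      haveI : CompactSpace K.subscheme := QuasiCompact.compactSpace_of_compactSpace K.subschemeι
      haveI := hU'
      exact unitBound π _ U' hG hGc) hT hTc
  exact ⟨F, hF, ⟨e.symm⟩⟩

end Proper

end GrothendieckExistenceProper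

end Literature.AlgebraicGeometry.FormalGeometry.WittGrothendieckExistence

end
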